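import Literature.Geometry.Symplectic.OrigamiMoserFlow
import Literature.Geometry.Symplectic.OrigamiMoserChartRep
import HarnessLib

/-!
# The origami Moser argument, VIII: `Ψ₁^* Ω₁ = Ω₀` near the zero section

Eighth file of the proof of the named fact `Literature.Geometry.Symplectic.exists_origamiCollarNormalForm`
(Cannas da Silva–Guillemin–Woodward 2000, Thm. 1).  For Moser data `D` on the collar `N × ℝ`
(`N` compact Hausdorff) and the Moser isotopy `Ψ = D.isotopy` of `OrigamiMoserFlow.lean`, the
pairing `f(s) = (Ω_s)_{Ψ_s z}(TΨ_s v, TΨ_s w)` is constant for `s ∈ [0, 1]` when `z` lies in the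
thin band (`MoserData.pairing_eq`), whence **`Ψ₁^* Ω₁ = Ω₀` on the band**
(`MoserData.pullback_isotopy_one`).  The proof reads flow, field and forms in the product chart
at `Ψ_{s₀} z` (pattern of `GrayStabilityFlow.lean`): the flow `Q = flowChart`, the field
`fieldChart` (the Moser field in the chart, `tangentCoordChange_moserField`), the representatives
`repA`, `repM` of `OrigamiMoserChartRep.lean` (`∂_s A = dμ̂`, `dA = 0`); the Moser equation and
the flow equation are transported to the chart, and `hasDerivAt_trackPairing₂`
(`OrigamiMoserCalculus.lean`) gives `f'(s₀) = 0`.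

Everything here is proved; no facts.

## References

* A. Cannas da Silva, V. Guillemin, C. Woodward, *On the unfolding of folded symplectic
  structures*, Math. Res. Lett. 7 (2000), proof of Thm. 1. [CannasGuilleminWoodward2000]
* D. McDuff, D. Salamon, *Introduction to Symplectic Topology*, 3rd ed. (2017), §3.2.
  [McDuffSalamon2017]
-/

noncomputable section

open scoped Manifold ContDiff Topology Bundle
open Set Function Filter
open Literature.Geometry.Kaehler Literature.Geometry.Manifold Literature.Topology.FourManifolds

namespace Literature.Geometry.Symplectic

namespace OrigamiMoser

local notation "E3" => EuclideanSpace ℝ (Fin 3)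
local notation "F4" => EuclideanSpace ℝ (Fin 3) × ℝ
local notation "I34" => ModelWithCorners.prod (𝓡 3) 𝓘(ℝ, ℝ)

namespace MoserData

variable {N : Type*} [TopologicalSpace N] [ChartedSpace (EuclideanSpace ℝ (Fin 3)) N]
  [IsManifold (𝓡 3) ∞ N] (D : MoserData N)

/-! ### The flow, the field and the forms read in a chart -/

section Flow

variable [CompactSpace N] [T2Space N]

/-- A chosen thin band `δ`: points with `|t| < δ` stay, for `s ∈ [0, 1]`, in `|t| < r/4`. [folklore] -/
def band : ℝ := Classical.choose D.exists_isotopy_band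

/-- The band is positive. [folklore] -/
theorem band_pos : 0 < D.band := (Classical.choose_spec D.exists_isotopy_band).1

/-- The band is at most `r/4`. [folklore] -/
theorem band_le : D.band ≤ D.margin / 4 := (Classical.choose_spec D.exists_isotopy_band).2.1

/-- Points of the band stay in the inner region for `s ∈ [0, 1]`. [folklore] -/
theorem isotopy_band_spec {s : ℝ} (hs : s ∈ Icc (0 : ℝ) 1) (n : N) {t : ℝ} (ht : |t| < D.band) :
    |(D.isotopy.toFun s (n, t)).2| < D.margin / 4 :=
  (Classical.choose_spec D.exists_isotopy_band).2.2 s hs n t ht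

/-- **The flow read in charts**: `Q(s, p) = φ_{x₁}(Ψ_s(φ_y⁻¹ p))`. [folklore] -/
def flowChart (x₁ y : N × ℝ) (z : ℝ × F4) : F4 :=
  extChartAt I34 x₁ (D.isotopy.toFun z.1 ((extChartAt I34 y).symm z.2))

/-- The flow read in charts is `C^∞` where the charts apply. [folklore] -/
theorem contDiffAt_flowChart (x₁ y : N × ℝ) {z : ℝ × F4} (hz : z.2 ∈ (extChartAt I34 y).target)
    (hs : D.isotopy.toFun z.1 ((extChartAt I34 y).symm z.2) ∈ (extChartAt I34 x₁).source) :
    ContDiffAt ℝ ∞ (D.flowChart x₁ y) z := by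
  rw [← contMDiffAt_iff_contDiffAt]
  have h1 : ContMDiffAt 𝓘(ℝ, ℝ × F4) (𝓘(ℝ, ℝ).prod I34) ∞
      (fun z : ℝ × F4 => ((z.1, (extChartAt I34 y).symm z.2) : ℝ × (N × ℝ))) z := by
    refine ContMDiffAt.prodMk ?_ ?_
    · exact contMDiffAt_iff_contDiffAt.2 contDiffAt_fst
    · exact ((contMDiffOn_extChartAt_symm y).contMDiffAt
        ((isOpen_extChartAt_target y).mem_nhds hz)).comp z
        (contMDiffAt_iff_contDiffAt.2 contDiffAt_snd)
  have h2 : ContMDiffAt (𝓘(ℝ, ℝ).prod I34) I34 ∞ (uncurry D.isotopy.toFun)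
      (z.1, (extChartAt I34 y).symm z.2) := D.isotopy.contMDiff.contMDiffAt
  have h3 : ContMDiffAt I34 𝓘(ℝ, F4) ∞ (extChartAt I34 x₁)
      (D.isotopy.toFun z.1 ((extChartAt I34 y).symm z.2)) :=
    contMDiffAt_extChartAt' (by rwa [← extChartAt_source I34])
  exact h3.comp z (h2.comp z h1)

-- the tangent spaces of `ℝ × (N × ℝ)` are the model space by definition
set_option backward.isDefEq.respectTransparency false in
/-- Each track `s ↦ Ψ_s y` is an integral curve of the cut-off field (projection of the
suspension track). [cite: HirschDT1976, Ch. 8 §1, Thm. 1.1] -/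
theorem hasMFDerivAt_track (y : N × ℝ) (s : ℝ) :
    HasMFDerivAt 𝓘(ℝ, ℝ) I34 (fun s => D.isotopy.toFun s y) s
      ((1 : ℝ →L[ℝ] ℝ).smulRight (D.cutField (s, D.isotopy.toFun s y))) := by
  have htrack := D.isotopy_track y s
  have h2 := (hasMFDerivAt_snd (I := 𝓘(ℝ, ℝ)) (I' := I34)
    (((s, D.isotopy.toFun s y) : ℝ × (N × ℝ)))).comp s htrack
  refine h2.congr_mfderiv ?_
  rw [ContinuousLinearMap.ext_iff]
  intro r
  rw [ContinuousLinearMap.comp_apply, ContinuousLinearMap.smulRight_apply,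
    ContinuousLinearMap.smulRight_apply, map_smul]
  rfl

/-- **The Moser field read in the chart at `x₁`**, as a function on `ℝ × (ℝ³ × ℝ)`. [folklore] -/
def fieldChart (x₁ : N × ℝ) (w : ℝ × F4) : F4 :=
  tangentCoordChange I34 ((extChartAt I34 x₁).symm w.2) x₁ ((extChartAt I34 x₁).symm w.2)
    (moserField D.Ωs D.μ w.1 ((extChartAt I34 x₁).symm w.2))

omit [CompactSpace N] [T2Space N] in
/-- The value of `fieldChart` at a chart image. [folklore] -/
theorem fieldChart_apply (x₁ : N × ℝ) (s : ℝ) {z : N × ℝ} (hz : z ∈ (extChartAt I34 x₁).source) :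
    D.fieldChart x₁ (s, extChartAt I34 x₁ z) = tangentCoordChange I34 z x₁ z (moserField D.Ωs D.μ s z) := by
  unfold fieldChart
  rw [(extChartAt I34 x₁).left_inv hz]

/-- **The flow equation in a chart**: while `Ψ_s y` lies in the chart at `x₁` and the cut-off
field is the Moser field at `(s, Ψ_s y)`, `d/ds φ_{x₁}(Ψ_s y) = X̂(s, φ_{x₁}(Ψ_s y))`.
[cite: McDuffSalamon2017, §3.2] -/
theorem hasDerivAt_extChartAt_track (x₁ y : N × ℝ) {s : ℝ}
    (hin : D.cutField (s, D.isotopy.toFun s y) = moserField D.Ωs D.μ s (D.isotopy.toFun s y))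
    (hsrc : D.isotopy.toFun s y ∈ (extChartAt I34 x₁).source) :
    HasDerivAt (fun s => extChartAt I34 x₁ (D.isotopy.toFun s y))
      (D.fieldChart x₁ (s, extChartAt I34 x₁ (D.isotopy.toFun s y))) s := by
  have hcurve : IsTimeDepMIntegralCurveOn (I := I34) (fun s => D.isotopy.toFun s y)
      (fun t x => D.cutField (t, x)) univ :=
    fun t _ => (D.hasMFDerivAt_track y t).hasMFDerivWithinAt
  have h := hcurve.hasDerivWithinAt (mem_univ s) hsrc
  rw [hasDerivWithinAt_univ] at h
  refine h.congr_deriv ?_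
  rw [D.fieldChart_apply x₁ s hsrc, ← hin]

/-- The flow equation for the flow read in charts: `∂_s Q = X̂(s, Q)`. [cite: McDuffSalamon2017, §3.2] -/
theorem fderiv_flowChart_eq (x₁ y : N × ℝ) {z : ℝ × F4} (hz : z.2 ∈ (extChartAt I34 y).target)
    (hs : D.isotopy.toFun z.1 ((extChartAt I34 y).symm z.2) ∈ (extChartAt I34 x₁).source)
    (hin : D.cutField (z.1, D.isotopy.toFun z.1 ((extChartAt I34 y).symm z.2)) =
      moserField D.Ωs D.μ z.1 (D.isotopy.toFun z.1 ((extChartAt I34 y).symm z.2))) :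
    fderiv ℝ (D.flowChart x₁ y) z (1, 0) = D.fieldChart x₁ (z.1, D.flowChart x₁ y z) := by
  obtain ⟨t, p⟩ := z
  have hd : HasFDerivAt (D.flowChart x₁ y) (fderiv ℝ (D.flowChart x₁ y) (t, p)) (t, p) :=
    ((D.contDiffAt_flowChart x₁ y hz hs).differentiableAt (by simp)).hasFDerivAt
  have hc₁ : HasDerivAt (fun s : ℝ => ((s, p) : ℝ × F4)) ((1 : ℝ), (0 : F4)) t :=
    (hasDerivAt_id t).prodMk (hasDerivAt_const t p)
  have h1 : HasDerivAt ((D.flowChart x₁ y) ∘ fun s : ℝ => ((s, p) : ℝ × F4))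
      (fderiv ℝ (D.flowChart x₁ y) (t, p) (1, 0)) t := hd.comp_hasDerivAt t hc₁
  have h2 : HasDerivAt (fun s => D.flowChart x₁ y (s, p))
      (D.fieldChart x₁ (t, D.flowChart x₁ y (t, p))) t :=
    D.hasDerivAt_extChartAt_track x₁ _ hin hs
  exact h1.unique h2

omit [T2Space N] in
/-- **The Moser equation in the chart**: `Â_s(X̂, u) = -μ̂(u)` at `(s, q)` for `q` in the chart
target over the good region. [cite: McDuffSalamon2017, §3.2] -/
theorem repA_fieldChart (x₁ : N × ℝ) {s : ℝ} {q : F4} (hq : q ∈ (extChartAt I34 x₁).target)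
    (hs : s ∈ Ioo (-D.margin) (1 + D.margin)) (ht : |((extChartAt I34 x₁).symm q).2| < D.margin) (u : F4) :
    D.repA x₁ (s, q) ![D.fieldChart x₁ (s, q), u] = -(D.repM x₁ (s, q) ![u]) := by
  set z := (extChartAt I34 x₁).symm q with hz
  have hzs : z ∈ (extChartAt I34 x₁).source := (extChartAt I34 x₁).map_target hq
  set L := tccEquiv x₁ z hzs with hL
  have hA : D.repA x₁ (s, q) = (D.Ωs s z).compContinuousLinearMap (L : F4 →L[ℝ] F4) := by
    show (D.Ωs s).inChart x₁ q = _
    rw [MForm.inChart_eq_of_mem_target _ hq]; rfl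
  have hM : D.repM x₁ (s, q) = (D.μ z).compContinuousLinearMap (L : F4 →L[ℝ] F4) := by
    show D.μ.inChart x₁ q = _
    rw [MForm.inChart_eq_of_mem_target _ hq]; rfl
  have hX : D.fieldChart x₁ (s, q) = L.symm (moserField D.Ωs D.μ s z) := rfl
  rw [hA, hM, hX, ContinuousAlternatingMap.compContinuousLinearMap_apply,
    ContinuousAlternatingMap.compContinuousLinearMap_apply, comp_vec2', comp_vec1']
  calc (D.Ωs s z) ![(L : F4 →L[ℝ] F4) (L.symm (moserField D.Ωs D.μ s z)), (L : F4 →L[ℝ] F4) u]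
      = (D.Ωs s z) ![moserField D.Ωs D.μ s z, (L : F4 →L[ℝ] F4) u] := by
        congr 1
        funext i; fin_cases i
        · exact L.apply_symm_apply _
        · rfl
    _ = -(D.μ z ![(L : F4 →L[ℝ] F4) u]) := D.moser_equation hs z.1 (t := z.2) ht ((L : F4 →L[ℝ] F4) u)

omit [T2Space N] in
/-- **The Moser field read in a chart is `C^∞`** at `(s, q)` over the good region. [folklore] -/
theorem contDiffAt_fieldChart (x₁ : N × ℝ) {s : ℝ} {q : F4} (hq : q ∈ (extChartAt I34 x₁).target)
    (hs : s ∈ Ioo (-D.margin) (1 + D.margin)) (ht : |((extChartAt I34 x₁).symm q).2| < D.margin) :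
    ContDiffAt ℝ ∞ (D.fieldChart x₁) (s, q) := by
  set z := (extChartAt I34 x₁).symm q with hz
  have hzs : z ∈ (extChartAt I34 x₁).source := (extChartAt I34 x₁).map_target hq
  have hF : ContMDiffAt (𝓘(ℝ, ℝ).prod I34) (ModelWithCorners.tangent I34) ∞
      (fun y : ℝ × (N × ℝ) => (⟨y.2, moserField D.Ωs D.μ y.1 y.2⟩ : TangentBundle I34 (N × ℝ)))
      (s, z) := by
    have h := D.contMDiffAt_field hs z.1 ht
    have : z = (z.1, z.2) := by simp
    rw [this]; exact h
  set e := trivializationAt F4 (TangentSpace I34) x₁ with he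
  have hsrc : (⟨z, moserField D.Ωs D.μ s z⟩ : TangentBundle I34 (N × ℝ)) ∈ e.source := by
    rw [he, Bundle.Trivialization.mem_source, TangentBundle.trivializationAt_baseSet,
      ← extChartAt_source I34]
    exact hzs
  have hF' : ContMDiffAt (𝓘(ℝ, ℝ).prod I34) ((I34).prod 𝓘(ℝ, F4)) ∞
      (fun y : ℝ × (N × ℝ) => (⟨y.2, moserField D.Ωs D.μ y.1 y.2⟩ : TangentBundle I34 (N × ℝ))) (s, z) := hF
  rw [e.contMDiffAt_iff
    (f := fun y : ℝ × (N × ℝ) => (⟨y.2, moserField D.Ωs D.μ y.1 y.2⟩ : TangentBundle I34 (N × ℝ)))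
    (x₀ := (s, z)) hsrc] at hF'
  have h2 := hF'.2
  -- compose with `(s', q') ↦ (s', φ⁻¹ q')`
  have hg : ContMDiffAt 𝓘(ℝ, ℝ × F4) (𝓘(ℝ, ℝ).prod I34) ∞
      (fun w : ℝ × F4 => ((w.1, (extChartAt I34 x₁).symm w.2) : ℝ × (N × ℝ))) (s, q) := by
    refine ContMDiffAt.prodMk ?_ ?_
    · exact contMDiffAt_iff_contDiffAt.2 contDiffAt_fst
    · exact ((contMDiffOn_extChartAt_symm x₁).contMDiffAt
        ((isOpen_extChartAt_target x₁).mem_nhds hq)).comp (s, q)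
        (contMDiffAt_iff_contDiffAt.2 contDiffAt_snd)
  have hcomp := h2.comp (s, q) hg
  rw [contMDiffAt_iff_contDiffAt] at hcomp
  refine hcomp.congr_of_eventuallyEq (Eventually.of_forall fun w => ?_)
  show D.fieldChart x₁ w = (e ⟨(extChartAt I34 x₁).symm w.2, moserField D.Ωs D.μ w.1 _⟩).2
  rw [he, TangentBundle.trivializationAt_apply]
  rfl

-- `mfderiv` is an `fderiv` between tangent spaces, which are the model space by definition
set_option backward.isDefEq.respectTransparency false in
/-- **The pairing `(Ω_s)_{Ψ_s y}(TΨ_s v, TΨ_s w)` is the transported pairing in charts.**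
[folklore] -/
theorem pairing_eq_trackPairing₂ (x₁ y : N × ℝ) (v w : F4) {s : ℝ}
    (hs : D.isotopy.toFun s y ∈ (extChartAt I34 x₁).source) :
    (D.Ωs s) (D.isotopy.toFun s y) ![mfderiv I34 I34 (D.isotopy.toFun s) y v,
        mfderiv I34 I34 (D.isotopy.toFun s) y w] =
      trackPairing₂ (D.repA x₁) (D.flowChart x₁ y) (extChartAt I34 y y) v w s := by
  set xs := D.isotopy.toFun s y with hxs
  have hp₀ : extChartAt I34 y y ∈ (extChartAt I34 y).target := mem_extChartAt_target y
  have hy : (extChartAt I34 y).symm (extChartAt I34 y y) = y := extChartAt_to_inv y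
  have hQ0 : D.flowChart x₁ y (s, extChartAt I34 y y) = extChartAt I34 x₁ xs := by
    rw [flowChart, hy]
  have hsy : D.isotopy.toFun s ((extChartAt I34 y).symm (extChartAt I34 y y)) ∈
      (extChartAt I34 x₁).source := by rwa [hy]
  have hQfull : DifferentiableAt ℝ (D.flowChart x₁ y) (s, extChartAt I34 y y) :=
    (D.contDiffAt_flowChart x₁ y hp₀ hsy).differentiableAt (by simp)
  have hQt : HasFDerivAt (fun p => D.flowChart x₁ y (s, p))
      ((fderiv ℝ (D.flowChart x₁ y) (s, extChartAt I34 y y)).comp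
        (ContinuousLinearMap.inr ℝ ℝ F4)) (extChartAt I34 y y) :=
    hQfull.hasFDerivAt.comp _ (hasFDerivAt_prodMk_right s _)
  -- the manifold derivative as the derivative of the written map
  have hmd : MDifferentiableAt I34 I34 (D.isotopy.toFun s) y :=
    ((D.isotopy.contMDiff_toFun s) y).mdifferentiableAt (by simp)
  have hev : writtenInExtChartAt I34 I34 y (D.isotopy.toFun s) =ᶠ[𝓝 (extChartAt I34 y y)]
      (extChartAt I34 xs ∘ (extChartAt I34 x₁).symm) ∘ fun p => D.flowChart x₁ y (s, p) := by
    have hcont : ContinuousAt (fun p => D.isotopy.toFun s ((extChartAt I34 y).symm p))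
        (extChartAt I34 y y) :=
      ((D.isotopy.contMDiff_toFun s).continuous.continuousAt).comp (continuousAt_extChartAt_symm y)
    have hmem : ∀ᶠ p in 𝓝 (extChartAt I34 y y),
        D.isotopy.toFun s ((extChartAt I34 y).symm p) ∈ (extChartAt I34 x₁).source :=
      hcont.preimage_mem_nhds ((isOpen_extChartAt_source x₁).mem_nhds hsy)
    filter_upwards [hmem] with p hp
    simp only [writtenInExtChartAt, flowChart, comp_apply]
    rw [(extChartAt I34 x₁).left_inv hp]
  have hT : HasFDerivAt (extChartAt I34 xs ∘ (extChartAt I34 x₁).symm)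
      (tangentCoordChange I34 x₁ xs xs) (D.flowChart x₁ y (s, extChartAt I34 y y)) := by
    have h := hasFDerivWithinAt_tangentCoordChange (I := I34) (x := x₁) (y := xs) (z := xs)
      ⟨hs, mem_extChartAt_source xs⟩
    rwa [ModelWithCorners.range_eq_univ, hasFDerivWithinAt_univ, ← hQ0] at h
  have hder : ∀ u : F4, mfderiv I34 I34 (D.isotopy.toFun s) y u =
      tangentCoordChange I34 x₁ xs xs (fderiv ℝ (D.flowChart x₁ y) (s, extChartAt I34 y y) ((0 : ℝ), u)) := by
    intro u
    rw [hmd.mfderiv, ModelWithCorners.range_eq_univ, fderivWithin_univ, hev.fderiv_eq,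
      (hT.comp (extChartAt I34 y y) hQt).fderiv]
    rfl
  rw [hder v, hder w]
  -- the right-hand side
  rw [trackPairing₂, hQ0]
  show _ = (D.Ωs s).inChart x₁ (extChartAt I34 x₁ xs) ![_, _]
  rw [MForm.inChart_eq_of_mem_target _ ((extChartAt I34 x₁).map_source hs),
    (extChartAt I34 x₁).left_inv hs, ContinuousAlternatingMap.compContinuousLinearMap_apply, comp_vec2']
  rfl

/-- The flow equation holds near `(s₀, φ_y y)` for the chart at `x₁ = Ψ_{s₀} y`, when
`(s₀, Ψ_{s₀} y)` lies in the inner region. [folklore] -/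
theorem eventually_fderiv_flowChart_eq (y : N × ℝ) {s₀ : ℝ}
    (hs₀ : s₀ ∈ Ioo (-(D.margin / 4)) (1 + D.margin / 4)) (hb : |(D.isotopy.toFun s₀ y).2| < D.margin / 4) :
    ∀ᶠ z : ℝ × F4 in 𝓝 (s₀, extChartAt I34 y y),
      fderiv ℝ (D.flowChart (D.isotopy.toFun s₀ y) y) z (1, 0) =
        D.fieldChart (D.isotopy.toFun s₀ y) (z.1, D.flowChart (D.isotopy.toFun s₀ y) y z) := by
  have hp₀ : extChartAt I34 y y ∈ (extChartAt I34 y).target := mem_extChartAt_target y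
  have hyy : (extChartAt I34 y).symm (extChartAt I34 y y) = y := extChartAt_to_inv y
  have hcont : ContinuousOn (fun z : ℝ × F4 => D.isotopy.toFun z.1 ((extChartAt I34 y).symm z.2))
      (univ ×ˢ (extChartAt I34 y).target) :=
    D.isotopy.contMDiff.continuous.comp_continuousOn (continuousOn_fst.prodMk
      ((continuousOn_extChartAt_symm y).comp continuousOn_snd
        (fun z (hz : z ∈ univ ×ˢ (extChartAt I34 y).target) => hz.2)))
  have hO : IsOpen ((extChartAt I34 (D.isotopy.toFun s₀ y)).source ∩ {x : N × ℝ | |x.2| < D.margin / 4}) :=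
    (isOpen_extChartAt_source _).inter (isOpen_lt (continuous_abs.comp continuous_snd) continuous_const)
  have hopen := hcont.isOpen_inter_preimage (isOpen_univ.prod (isOpen_extChartAt_target y)) hO
  have hmem : ((s₀, extChartAt I34 y y) : ℝ × F4) ∈ (univ ×ˢ (extChartAt I34 y).target) ∩
      (fun z : ℝ × F4 => D.isotopy.toFun z.1 ((extChartAt I34 y).symm z.2)) ⁻¹'
        ((extChartAt I34 (D.isotopy.toFun s₀ y)).source ∩ {x : N × ℝ | |x.2| < D.margin / 4}) := by
    refine ⟨⟨mem_univ _, hp₀⟩, ?_⟩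
    show D.isotopy.toFun s₀ ((extChartAt I34 y).symm (extChartAt I34 y y)) ∈
      (extChartAt I34 (D.isotopy.toFun s₀ y)).source ∩ {x : N × ℝ | |x.2| < D.margin / 4}
    rw [hyy]
    exact ⟨mem_extChartAt_source _, hb⟩
  have htime : ∀ᶠ z : ℝ × F4 in 𝓝 (s₀, extChartAt I34 y y), z.1 ∈ Ioo (-(D.margin / 4)) (1 + D.margin / 4) :=
    continuousAt_fst.preimage_mem_nhds (isOpen_Ioo.mem_nhds hs₀)
  filter_upwards [hopen.mem_nhds hmem, htime] with z hz hzt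
  obtain ⟨⟨-, hz2⟩, hzs, hzb⟩ := hz
  refine D.fderiv_flowChart_eq _ y hz2 hzs (D.cutField_eq (Ioo_subset_Icc_self hzt) ?_)
  have h : |(D.isotopy.toFun z.1 ((extChartAt I34 y).symm z.2)).2| < D.margin / 4 := hzb
  rw [abs_lt] at h
  exact ⟨h.1.le, h.2.le⟩

omit [T2Space N] in
/-- The Moser equation holds in the chart at `x₁` near `(s₀, φ_{x₁} x₁)`, when `(s₀, x₁)` lies in
the good region. [folklore] -/
theorem eventually_repA_fieldChart (x₁ : N × ℝ) {s₀ : ℝ} (hs₀ : s₀ ∈ Ioo (-D.margin) (1 + D.margin))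
    (hx₁ : |x₁.2| < D.margin) :
    ∀ᶠ wq : ℝ × F4 in 𝓝 (s₀, extChartAt I34 x₁ x₁), ∀ u : F4,
      D.repA x₁ wq ![D.fieldChart x₁ wq, u] = -(D.repM x₁ wq ![u]) := by
  have hq₀t : extChartAt I34 x₁ x₁ ∈ (extChartAt I34 x₁).target := mem_extChartAt_target x₁
  have hq₀s : (extChartAt I34 x₁).symm (extChartAt I34 x₁ x₁) = x₁ := extChartAt_to_inv x₁
  have hcontq : ContinuousOn (fun wq : ℝ × F4 => ((extChartAt I34 x₁).symm wq.2).2)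
      (univ ×ˢ (extChartAt I34 x₁).target) :=
    continuous_snd.comp_continuousOn ((continuousOn_extChartAt_symm x₁).comp continuousOn_snd
      fun wq (hwq : wq ∈ univ ×ˢ (extChartAt I34 x₁).target) => hwq.2)
  have hopen := hcontq.isOpen_inter_preimage (isOpen_univ.prod (isOpen_extChartAt_target x₁))
    (isOpen_lt continuous_abs continuous_const : IsOpen {t : ℝ | |t| < D.margin})
  have hmem : ((s₀, extChartAt I34 x₁ x₁) : ℝ × F4) ∈ (univ ×ˢ (extChartAt I34 x₁).target) ∩
      (fun wq : ℝ × F4 => ((extChartAt I34 x₁).symm wq.2).2) ⁻¹' {t : ℝ | |t| < D.margin} := by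
    refine ⟨⟨mem_univ _, hq₀t⟩, ?_⟩
    show |((extChartAt I34 x₁).symm (extChartAt I34 x₁ x₁)).2| < D.margin
    rw [hq₀s]; exact hx₁
  have htime : ∀ᶠ wq : ℝ × F4 in 𝓝 (s₀, extChartAt I34 x₁ x₁), wq.1 ∈ Ioo (-D.margin) (1 + D.margin) :=
    continuousAt_fst.preimage_mem_nhds (isOpen_Ioo.mem_nhds hs₀)
  filter_upwards [hopen.mem_nhds hmem, htime] with wq hwq hwqt u
  obtain ⟨⟨-, hq⟩, ht⟩ := hwq
  exact D.repA_fieldChart x₁ (s := wq.1) (q := wq.2) hq hwqt ht u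

/-- **`f'(s₀) = 0` for the pairing along a track in the inner region**: for `y` and `s₀` with
`s₀ ∈ (-r/4, 1 + r/4)` and `|(Ψ_{s₀} y).2| < r/4`, the pairing
`f(s) = (Ω_s)_{Ψ_s y}(TΨ_s v, TΨ_s w)` has zero derivative at `s₀`.
[cite: CannasGuilleminWoodward2000, proof of Thm. 1] -/
theorem hasDerivAt_pairing (y : N × ℝ) (v w : F4) {s₀ : ℝ}
    (hs₀ : s₀ ∈ Ioo (-(D.margin / 4)) (1 + D.margin / 4)) (hb : |(D.isotopy.toFun s₀ y).2| < D.margin / 4) :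
    HasDerivAt (fun s => (D.Ωs s) (D.isotopy.toFun s y)
      ![mfderiv I34 I34 (D.isotopy.toFun s) y v, mfderiv I34 I34 (D.isotopy.toFun s) y w]) 0 s₀ := by
  have hp₀ : extChartAt I34 y y ∈ (extChartAt I34 y).target := mem_extChartAt_target y
  have hyy : (extChartAt I34 y).symm (extChartAt I34 y y) = y := extChartAt_to_inv y
  have htrack : Continuous fun s => D.isotopy.toFun s y :=
    D.isotopy.contMDiff.continuous.comp (continuous_id.prodMk continuous_const)
  have hs₀' : s₀ ∈ Ioo (-D.margin) (1 + D.margin) := ⟨by linarith [hs₀.1, D.margin_pos], by linarith [hs₀.2, D.margin_pos]⟩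
  have hx₁t : |(D.isotopy.toFun s₀ y).2| < D.margin := by linarith [hb, D.margin_pos]
  have hq₀ : D.flowChart (D.isotopy.toFun s₀ y) y (s₀, extChartAt I34 y y) =
      extChartAt I34 (D.isotopy.toFun s₀ y) (D.isotopy.toFun s₀ y) := by
    rw [flowChart, hyy]
  have hq₀t : extChartAt I34 (D.isotopy.toFun s₀ y) (D.isotopy.toFun s₀ y) ∈
      (extChartAt I34 (D.isotopy.toFun s₀ y)).target := mem_extChartAt_target _
  have hq₀s : (extChartAt I34 (D.isotopy.toFun s₀ y)).symm
      (extChartAt I34 (D.isotopy.toFun s₀ y) (D.isotopy.toFun s₀ y)) = D.isotopy.toFun s₀ y := extChartAt_to_inv _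
  -- the derivative of the transported pairing at `s₀`
  have hder : HasDerivAt (trackPairing₂ (D.repA (D.isotopy.toFun s₀ y)) (D.flowChart (D.isotopy.toFun s₀ y) y)
      (extChartAt I34 y y) v w) 0 s₀ := by
    refine hasDerivAt_trackPairing₂ (Mu := D.repM (D.isotopy.toFun s₀ y))
      (X := D.fieldChart (D.isotopy.toFun s₀ y)) v w ?_ ?_ ?_ ?_
      (D.eventually_fderiv_flowChart_eq y hs₀ hb) ?_ ?_ ?_
    · rw [hq₀]; exact (D.contDiffAt_repA _ hq₀t).of_le (by norm_cast)
    · rw [hq₀]; exact (D.contDiffAt_repM _ hq₀t).of_le (by norm_cast)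
    · rw [hq₀]
      exact (D.contDiffAt_fieldChart _ hq₀t hs₀' (by rw [hq₀s]; exact hx₁t)).of_le (by norm_cast)
    · exact (D.contDiffAt_flowChart _ y hp₀ (by rw [hyy]; exact mem_extChartAt_source _)).of_le
        (by norm_cast)
    · rw [hq₀]; exact D.eventually_repA_fieldChart _ hs₀' hx₁t
    · intro a b
      rw [hq₀]; exact D.repA_dot _ hq₀t a b
    · intro a b c
      rw [hq₀]; exact D.repA_closed _ hq₀t a b c
  -- transfer to the pairing on the manifold
  have hT1 : ∀ᶠ s in 𝓝 s₀, D.isotopy.toFun s y ∈ (extChartAt I34 (D.isotopy.toFun s₀ y)).source :=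
    htrack.continuousAt.preimage_mem_nhds ((isOpen_extChartAt_source _).mem_nhds (mem_extChartAt_source _))
  have hev : (fun s => (D.Ωs s) (D.isotopy.toFun s y)
      ![mfderiv I34 I34 (D.isotopy.toFun s) y v, mfderiv I34 I34 (D.isotopy.toFun s) y w]) =ᶠ[𝓝 s₀]
        trackPairing₂ (D.repA (D.isotopy.toFun s₀ y)) (D.flowChart (D.isotopy.toFun s₀ y) y)
          (extChartAt I34 y y) v w := by
    filter_upwards [hT1] with s hs
    exact D.pairing_eq_trackPairing₂ _ y v w hs
  exact hder.congr_of_eventuallyEq hev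

/-- **The pairing is constant on `[0, 1]` over the thin band**: for `|y.2| < δ`,
`(Ω_s)_{Ψ_s y}(TΨ_s v, TΨ_s w) = (Ω₀)_y(v, w)` for `s ∈ [0, 1]`.
[cite: CannasGuilleminWoodward2000, proof of Thm. 1] -/
theorem pairing_eq (n : N) {t : ℝ} (ht : |t| < D.band) (v w : F4) {s : ℝ} (hs : s ∈ Icc (0 : ℝ) 1) :
    (D.Ωs s) (D.isotopy.toFun s (n, t))
        ![mfderiv I34 I34 (D.isotopy.toFun s) (n, t) v, mfderiv I34 I34 (D.isotopy.toFun s) (n, t) w] =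
      D.Ω₀ (n, t) ![v, w] := by
  have hr := D.margin_pos
  set f : ℝ → ℝ := fun s => (D.Ωs s) (D.isotopy.toFun s (n, t))
    ![mfderiv I34 I34 (D.isotopy.toFun s) (n, t) v, mfderiv I34 I34 (D.isotopy.toFun s) (n, t) w] with hf
  have hderiv : ∀ s ∈ Icc (0 : ℝ) 1, HasDerivAt f 0 s := fun s hs =>
    D.hasDerivAt_pairing (n, t) v w ⟨by linarith [hs.1], by linarith [hs.2]⟩ (D.isotopy_band_spec hs n ht)
  have hcont : ContinuousOn f (Icc 0 1) := fun s hs => (hderiv s hs).continuousAt.continuousWithinAt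
  have hconst := constant_of_has_deriv_right_zero hcont
    (fun s hs => (hderiv s (Ico_subset_Icc_self hs)).hasDerivWithinAt) s hs
  have h0 : f 0 = D.Ω₀ (n, t) ![v, w] := by
    simp only [hf]
    rw [D.isotopy.map_zero]
    simp only [mfderiv_id, id_eq]
    show (D.Ωs 0) (n, t) ![v, w] = _
    rw [Ωs_apply, zero_smul, add_zero]
  rw [← h0]
  exact hconst

/-- **`Ψ₁^* Ω₁ = Ω₀` on the thin band.** [cite: CannasGuilleminWoodward2000, proof of Thm. 1] -/
theorem pullback_isotopy_one (n : N) {t : ℝ} (ht : |t| < D.band) :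
    ((D.Ωs 1).pullback I34 (D.isotopy.toFun 1)) (n, t) = D.Ω₀ (n, t) := by
  ext V
  have hV : V = ![V 0, V 1] := by
    funext i; fin_cases i <;> rfl
  rw [MForm.pullback_apply, hV]
  have h := D.pairing_eq n ht (V 0) (V 1) (s := 1) ⟨zero_le_one, le_rfl⟩
  refine Eq.trans ?_ h
  congr 1
  funext i; fin_cases i <;> rfl

end Flow

end MoserData

end OrigamiMoser

end Literature.Geometry.Symplectic

end
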